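import Literature.Computability.AlgebraicComplexity.Kron444HullCheck
import HarnessLib

/-!
# `Kron(4,4,4) ⊆ conv(328 vertices)`: certificate checks, part 2/14

Proofs file (computations only): the node checks of `Kron444HullCheck.lean` for the chunks
13 … 24 of the certificate, each decided by the kernel (`decide +kernel`; `maxHeartbeats 0`:
a chunk is ≈ 10⁵–10⁶ kernel reductions). Assembled in `Kron444Hull.lean`. [folklore]
-/

set_option Elab.async false

namespace Literature.Computability.AlgebraicComplexity.Kron444Hull

/-- Nodes `325 … 349` of the certificate (chunk `13`) pass `checkNodeRec`. [folklore] -/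
theorem checkChunk_13 : checkChunk 13 25 = true := by
  set_option maxHeartbeats 0 in decide +kernel

/-- Nodes `350 … 374` of the certificate (chunk `14`) pass `checkNodeRec`. [folklore] -/
theorem checkChunk_14 : checkChunk 14 25 = true := by
  set_option maxHeartbeats 0 in decide +kernel

/-- Nodes `375 … 399` of the certificate (chunk `15`) pass `checkNodeRec`. [folklore] -/
theorem checkChunk_15 : checkChunk 15 25 = true := by
  set_option maxHeartbeats 0 in decide +kernel

/-- Nodes `400 … 424` of the certificate (chunk `16`) pass `checkNodeRec`. [folklore] -/
theorem checkChunk_16 : checkChunk 16 25 = true := by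
  set_option maxHeartbeats 0 in decide +kernel

/-- Nodes `425 … 449` of the certificate (chunk `17`) pass `checkNodeRec`. [folklore] -/
theorem checkChunk_17 : checkChunk 17 25 = true := by
  set_option maxHeartbeats 0 in decide +kernel

/-- Nodes `450 … 474` of the certificate (chunk `18`) pass `checkNodeRec`. [folklore] -/
theorem checkChunk_18 : checkChunk 18 25 = true := by
  set_option maxHeartbeats 0 in decide +kernel

/-- Nodes `475 … 499` of the certificate (chunk `19`) pass `checkNodeRec`. [folklore] -/
theorem checkChunk_19 : checkChunk 19 25 = true := by
  set_option maxHeartbeats 0 in decide +kernel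

/-- Nodes `500 … 524` of the certificate (chunk `20`) pass `checkNodeRec`. [folklore] -/
theorem checkChunk_20 : checkChunk 20 25 = true := by
  set_option maxHeartbeats 0 in decide +kernel

/-- Nodes `525 … 549` of the certificate (chunk `21`) pass `checkNodeRec`. [folklore] -/
theorem checkChunk_21 : checkChunk 21 25 = true := by
  set_option maxHeartbeats 0 in decide +kernel

/-- Nodes `550 … 574` of the certificate (chunk `22`) pass `checkNodeRec`. [folklore] -/
theorem checkChunk_22 : checkChunk 22 25 = true := by
  set_option maxHeartbeats 0 in decide +kernel

/-- Nodes `575 … 599` of the certificate (chunk `23`) pass `checkNodeRec`. [folklore] -/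
theorem checkChunk_23 : checkChunk 23 25 = true := by
  set_option maxHeartbeats 0 in decide +kernel

/-- Nodes `600 … 624` of the certificate (chunk `24`) pass `checkNodeRec`. [folklore] -/
theorem checkChunk_24 : checkChunk 24 25 = true := by
  set_option maxHeartbeats 0 in decide +kernel

end Literature.Computability.AlgebraicComplexity.Kron444Hull
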